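import Summits.CriticalPhenomena.CardyFormulaZ2.Theorems.StripClusterRates.Negative.SubmultiplicativeOne
import Literature.Probability.RandomPlanarGeometry.KlebanZagierTheorem2
import Literature.Probability.RandomPlanarGeometry.CardyFunctionIncBeta

/-!
# Stub `composeOne` (G) of line `two-cluster-rate-is-stationary-gap`, crux `StripClusterRates`

The analytic glue of the `γ₁` half of the crux in CARDY ORDER (reshape 2 of the line, lead
prover-line-stmt-CriticalPhenomena-13878-1). Inputs (the four other registered stubs of the half, taken
as hypotheses verbatim):

* A (sandwich, upper): `γ₁(n) ≤ (log 2 − log p₁(m,n))/(m − n)` for every `m > n` — width-uniform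
  super-multiplicativity + Fekete; together with the landed `rateOne_ge_finite`
  (`γ₁(n) ≥ −log p₁(m,n)/(m+1)`, sub-multiplicativity) this is the transfer-matrix-order /
  Cardy-order sandwich;
* B: `log λ(it)/t → −π` (`λ = KlebanZagier.lamR`, the modulus of the corner-marked rectangle of
  aspect `t`, tree `rectangle_crossRatio_eq_lamR`);
* C: `log F(η)/log η → 1/3` as `η → 0⁺` (`F = cardyFunction`);
* R: Cardy's formula for the corner-marked lattice rectangles of integer aspect `A`, in lattice form:
  `p₁(Ak − 2, k − 2) → F(λ(iA))` as `k → ∞` (every width `w = k − 2` occurs).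

Output: for EVERY rate function `γ` (`−log p₁(m,n)/m → γ(n)` for `n ≥ 1`), `n·γ(n) → π/3`.

Proof. (1) From B and C, `c(A)/A → π/3` where `c(A) = −log F(λ(iA))` (product of the two limits along
`η = λ(it) → 0⁺`), hence also `(log 2 + c(A))/(A − 1) → π/3`. (2) For a fixed aspect `A ≥ 2` and
widths `w → ∞`, with `m_w = A(w+2) − 2`: R gives `p₁(m_w, w) → F(λ(iA)) > 0`, so the sandwich bounds
`w·(−log p₁(m_w,w))/(m_w + 1) ≤ w·γ(w) ≤ w·(log 2 − log p₁(m_w,w))/(m_w − w)` have limits `c(A)/A` and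
`(log 2 + c(A))/(A − 1)`. (3) Given `ε`, choose `A` with both within `ε/2` of `π/3`; then eventually
`|w·γ(w) − π/3| < ε`. No parity or interpolation is needed because R covers every width.
-/

noncomputable section

namespace Summit.CriticalPhenomena.CardyFormulaZ2.Cruxes.StripClusterRates.TwoClusterRateIsStationaryGap

open Filter Topology Set
open Literature.Probability.Percolation (crossingProb half)
open Literature.Probability.RandomPlanarGeometry (cardyFunction strictMonoOn_cardyFunction_holds
  cardyFunction_zero)
open Literature.Probability.RandomPlanarGeometry.KlebanZagier (lamR lamR_mem_Ioo tendsto_lamR_atTop)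
open Summit.CriticalPhenomena.CardyFormulaZ2.Theorems.StripClusterRates.Negative (pOne_ge rateOne_ge_finite)

/-! ## Small analytic facts -/

/-- `0 < p₁(m,n)` (the straight open path, landed `pOne_ge`). -/
theorem g_pOne_pos (m n : ℕ) : 0 < crossingProb half m n :=
  lt_of_lt_of_le (by positivity) (pOne_ge m n)

/-- Cardy's function is positive on `(0,1)` (`F` strictly increasing on `[0,1]`, `F 0 = 0`). -/
theorem g_cardyFunction_pos {η : ℝ} (hη : η ∈ Ioo (0 : ℝ) 1) : 0 < cardyFunction η := by
  have hmono := strictMonoOn_cardyFunction_holds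
  have h0 : (0 : ℝ) ∈ Icc (0 : ℝ) 1 := ⟨le_rfl, zero_le_one⟩
  have hη' : η ∈ Icc (0 : ℝ) 1 := ⟨hη.1.le, hη.2.le⟩
  have := hmono h0 hη' hη.1
  rwa [cardyFunction_zero] at this

/-- `F(λ(it)) > 0` for `t > 0`. -/
theorem g_cardy_lamR_pos {t : ℝ} (ht : 0 < t) : 0 < cardyFunction (lamR t) :=
  g_cardyFunction_pos (lamR_mem_Ioo ht)

/-- `λ(it) → 0⁺` as `t → ∞` (within `(0, ∞)`). -/
theorem g_tendsto_lamR_nhdsGT : Tendsto lamR atTop (𝓝[>] 0) := by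
  refine tendsto_nhdsWithin_iff.2 ⟨tendsto_lamR_atTop, ?_⟩
  filter_upwards [eventually_gt_atTop (0 : ℝ)] with t ht
  exact (lamR_mem_Ioo ht).1

/-- **Step 1 (real form).** From B and C: `−log F(λ(it))/t → π/3`. -/
theorem g_tendsto_negLog_cardy_lamR_div
    (hB : Tendsto (fun t : ℝ ↦ Real.log (lamR t) / t) atTop (𝓝 (-Real.pi)))
    (hC : Tendsto (fun η : ℝ ↦ Real.log (cardyFunction η) / Real.log η) (𝓝[>] 0) (𝓝 (1 / 3 : ℝ))) :
    Tendsto (fun t : ℝ ↦ -Real.log (cardyFunction (lamR t)) / t) atTop (𝓝 (Real.pi / 3)) := by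
  have hC' := hC.comp g_tendsto_lamR_nhdsGT
  have hprod := (hC'.mul hB).neg
  have hval : -((1 / 3 : ℝ) * -Real.pi) = Real.pi / 3 := by ring
  rw [hval] at hprod
  refine hprod.congr' ?_
  filter_upwards [eventually_gt_atTop (0 : ℝ)] with t ht
  have hl := lamR_mem_Ioo ht
  have hlog : Real.log (lamR t) ≠ 0 := (Real.log_neg hl.1 hl.2).ne
  simp only [Function.comp_apply]
  rw [neg_div, div_mul_div_cancel₀ hlog]

/-- **Step 1 (integer aspects).** `c(A)/A → π/3`, `c(A) = −log F(λ(iA))`. -/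
theorem g_tendsto_cA_div
    (hB : Tendsto (fun t : ℝ ↦ Real.log (lamR t) / t) atTop (𝓝 (-Real.pi)))
    (hC : Tendsto (fun η : ℝ ↦ Real.log (cardyFunction η) / Real.log η) (𝓝[>] 0) (𝓝 (1 / 3 : ℝ))) :
    Tendsto (fun A : ℕ ↦ -Real.log (cardyFunction (lamR A)) / (A : ℝ)) atTop (𝓝 (Real.pi / 3)) :=
  (g_tendsto_negLog_cardy_lamR_div hB hC).comp tendsto_natCast_atTop_atTop

/-- **Step 1 (upper constant).** `(log 2 + c(A))/(A − 1) → π/3`. -/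
theorem g_tendsto_UA
    (hB : Tendsto (fun t : ℝ ↦ Real.log (lamR t) / t) atTop (𝓝 (-Real.pi)))
    (hC : Tendsto (fun η : ℝ ↦ Real.log (cardyFunction η) / Real.log η) (𝓝[>] 0) (𝓝 (1 / 3 : ℝ))) :
    Tendsto (fun A : ℕ ↦ (Real.log 2 + -Real.log (cardyFunction (lamR A))) / ((A : ℝ) - 1)) atTop
      (𝓝 (Real.pi / 3)) := by
  have hc := g_tendsto_cA_div hB hC
  -- `log 2 / A → 0`
  have h2 : Tendsto (fun A : ℕ ↦ Real.log 2 / (A : ℝ)) atTop (𝓝 0) :=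
    tendsto_const_div_atTop_nhds_zero_nat _
  -- `A / (A - 1) → 1`
  have hinv : Tendsto (fun A : ℕ ↦ (A : ℝ)⁻¹) atTop (𝓝 0) := tendsto_inv_atTop_nhds_zero_nat
  have hratio : Tendsto (fun A : ℕ ↦ (A : ℝ) / ((A : ℝ) - 1)) atTop (𝓝 1) := by
    have h1 : Tendsto (fun A : ℕ ↦ (1 : ℝ) / (1 - (A : ℝ)⁻¹)) atTop (𝓝 (1 / (1 - 0))) :=
      tendsto_const_nhds.div (tendsto_const_nhds.sub hinv) (by norm_num)
    rw [sub_zero, div_one] at h1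
    refine h1.congr' ?_
    filter_upwards [eventually_ge_atTop 2] with A hA
    have hA' : (2 : ℝ) ≤ A := by exact_mod_cast hA
    have hA0 : (A : ℝ) ≠ 0 := by positivity
    field_simp
  have hsum := ((h2.add hc).mul hratio)
  rw [zero_add, mul_one] at hsum
  refine hsum.congr' ?_
  filter_upwards [eventually_ge_atTop 2] with A hA
  have hA' : (2 : ℝ) ≤ A := by exact_mod_cast hA
  have hA0 : (A : ℝ) ≠ 0 := by positivity
  have hA1 : (A : ℝ) - 1 ≠ 0 := by linarith
  field_simp

/-! ## Step 2: the sandwich at a fixed aspect `A ≥ 2` -/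

/-- The length `m_w = A(w+2) − 2` cast to `ℝ`. -/
theorem g_cast_m (A w : ℕ) (hA : 1 ≤ A) :
    ((A * (w + 2) - 2 : ℕ) : ℝ) = (A : ℝ) * w + 2 * A - 2 := by
  have h2 : 2 ≤ A * (w + 2) := le_trans (by omega) (Nat.mul_le_mul hA (Nat.le_add_left 2 w))
  rw [Nat.cast_sub h2]
  push_cast
  ring

/-- **Upper sequence limit**: `w·(log 2 − log p₁(m_w,w))/(m_w − w) → (log 2 + c(A))/(A − 1)`. -/
theorem g_tendsto_upper {A : ℕ} (hA : 2 ≤ A) {P : ℝ} (hP : 0 < P)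
    (hR : Tendsto (fun w : ℕ ↦ crossingProb half (A * (w + 2) - 2) w) atTop (𝓝 P)) :
    Tendsto (fun w : ℕ ↦ (w : ℝ) * ((Real.log 2 - Real.log (crossingProb half (A * (w + 2) - 2) w)) /
      (((A * (w + 2) - 2 : ℕ) : ℝ) - w))) atTop
      (𝓝 ((Real.log 2 + -Real.log P) / ((A : ℝ) - 1))) := by
  have hA1 : (1 : ℕ) ≤ A := le_trans (by norm_num) hA
  have hAr : (2 : ℝ) ≤ A := by exact_mod_cast hA
  have hlog := hR.log hP.ne'
  have hnum : Tendsto (fun w : ℕ ↦ Real.log 2 - Real.log (crossingProb half (A * (w + 2) - 2) w)) atTop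
      (𝓝 (Real.log 2 + -Real.log P)) := by
    simpa [sub_eq_add_neg] using tendsto_const_nhds.sub hlog
  -- `w / ((A-1) w + 2A - 2) = (1/(A-1)) · w/(w+2) → 1/(A-1)`
  have hden : Tendsto (fun w : ℕ ↦ (w : ℝ) / (((A * (w + 2) - 2 : ℕ) : ℝ) - w)) atTop
      (𝓝 (1 / ((A : ℝ) - 1))) := by
    have h1 : Tendsto (fun w : ℕ ↦ (1 / ((A : ℝ) - 1)) * ((w : ℝ) / (w + 2))) atTop
        (𝓝 ((1 / ((A : ℝ) - 1)) * 1)) :=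
      tendsto_const_nhds.mul (tendsto_natCast_div_add_atTop (2 : ℝ))
    rw [mul_one] at h1
    refine h1.congr' (Eventually.of_forall fun w ↦ ?_)
    have hA1' : (A : ℝ) - 1 ≠ 0 := by linarith
    have hw2 : (w : ℝ) + 2 ≠ 0 := by positivity
    dsimp only
    rw [g_cast_m A w hA1, show (A : ℝ) * w + 2 * A - 2 - w = ((A : ℝ) - 1) * (w + 2) by ring]
    field_simp
  have := hnum.mul hden
  rw [← div_eq_mul_one_div] at this
  refine this.congr' (Eventually.of_forall fun w ↦ ?_)
  ring

/-- **Lower sequence limit**: `w·(−log p₁(m_w,w))/(m_w + 1) → c(A)/A`. -/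
theorem g_tendsto_lower {A : ℕ} (hA : 2 ≤ A) {P : ℝ} (hP : 0 < P)
    (hR : Tendsto (fun w : ℕ ↦ crossingProb half (A * (w + 2) - 2) w) atTop (𝓝 P)) :
    Tendsto (fun w : ℕ ↦ (w : ℝ) * (-Real.log (crossingProb half (A * (w + 2) - 2) w) /
      (((A * (w + 2) - 2 : ℕ) : ℝ) + 1))) atTop (𝓝 (-Real.log P / (A : ℝ))) := by
  have hA1 : (1 : ℕ) ≤ A := le_trans (by norm_num) hA
  have hAr : (2 : ℝ) ≤ A := by exact_mod_cast hA
  have hlog := (hR.log hP.ne').neg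
  -- `w / (A w + 2A - 1) = (1/A) · w/(w + (2A-1)/A) → 1/A`
  have hden : Tendsto (fun w : ℕ ↦ (w : ℝ) / (((A * (w + 2) - 2 : ℕ) : ℝ) + 1)) atTop
      (𝓝 (1 / (A : ℝ))) := by
    have h1 : Tendsto (fun w : ℕ ↦ (1 / (A : ℝ)) * ((w : ℝ) / (w + (2 * A - 1) / A))) atTop
        (𝓝 ((1 / (A : ℝ)) * 1)) :=
      tendsto_const_nhds.mul (tendsto_natCast_div_add_atTop ((2 * A - 1) / A : ℝ))
    rw [mul_one] at h1
    refine h1.congr' (Eventually.of_forall fun w ↦ ?_)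
    have hA0 : (A : ℝ) ≠ 0 := by positivity
    have hw0 : (0 : ℝ) ≤ w := by positivity
    have hd : (w : ℝ) * A + (2 * A - 1) ≠ 0 := by nlinarith
    dsimp only
    rw [g_cast_m A w hA1, show (A : ℝ) * w + 2 * A - 2 + 1 = (w : ℝ) * A + (2 * A - 1) by ring]
    field_simp
  have := hlog.mul hden
  rw [← div_eq_mul_one_div] at this
  refine this.congr' (Eventually.of_forall fun w ↦ ?_)
  ring

/-! ## The registered stub -/

/-- **G — `stub_composeOne`**: the four Cardy-order inputs A (sandwich, upper), B (`log λ(it)/t → −π`),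
C (`log F(η)/log η → 1/3`), R (lattice Cardy for corner-marked rectangles of integer aspect) imply
`n·γ₁(n) → π/3` for every one-cluster rate function `γ₁`. [folklore] -/
theorem stub_composeOne :
    (∀ n : ℕ, 1 ≤ n → ∀ γ : ℝ,
      Tendsto (fun m : ℕ ↦ -Real.log (crossingProb half m n) / (m : ℝ)) atTop (𝓝 γ) →
      ∀ m : ℕ, n < m → γ ≤ (Real.log 2 - Real.log (crossingProb half m n)) / ((m : ℝ) - n)) →
    Tendsto (fun t : ℝ ↦ Real.log (Literature.Probability.RandomPlanarGeometry.KlebanZagier.lamR t) / t)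
      atTop (𝓝 (-Real.pi)) →
    Tendsto (fun η : ℝ ↦ Real.log (Literature.Probability.RandomPlanarGeometry.cardyFunction η) / Real.log η)
      (𝓝[>] 0) (𝓝 (1 / 3 : ℝ)) →
    (∀ A : ℕ, 1 ≤ A → Tendsto (fun k : ℕ ↦ crossingProb half (A * k - 2) (k - 2)) atTop
      (𝓝 (Literature.Probability.RandomPlanarGeometry.cardyFunction
        (Literature.Probability.RandomPlanarGeometry.KlebanZagier.lamR A)))) →
    ∀ γ : ℕ → ℝ,
      (∀ n : ℕ, 1 ≤ n → Tendsto (fun m : ℕ ↦ -Real.log (crossingProb half m n) / (m : ℝ)) atTop (𝓝 (γ n))) →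
      Tendsto (fun n : ℕ ↦ (n : ℝ) * γ n) atTop (𝓝 (Real.pi / 3)) := by
  intro hA hB hC hR γ hγ
  rw [Metric.tendsto_atTop]
  intro ε hε
  -- Step 1/3: choose the aspect `A`
  have hcA := g_tendsto_cA_div hB hC
  have hUA := g_tendsto_UA hB hC
  have hε2 : 0 < ε / 2 := by linarith
  obtain ⟨A, hA2, hAlow, hAup⟩ : ∃ A : ℕ, 2 ≤ A ∧
      Real.pi / 3 - ε / 2 < -Real.log (cardyFunction (lamR A)) / (A : ℝ) ∧
      (Real.log 2 + -Real.log (cardyFunction (lamR A))) / ((A : ℝ) - 1) < Real.pi / 3 + ε / 2 := by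
    have e1 := hcA.eventually (lt_mem_nhds (show Real.pi / 3 - ε / 2 < Real.pi / 3 by linarith))
    have e2 := hUA.eventually (gt_mem_nhds (show Real.pi / 3 < Real.pi / 3 + ε / 2 by linarith))
    exact ((eventually_ge_atTop 2).and (e1.and e2)).exists.imp fun A h ↦ ⟨h.1, h.2.1, h.2.2⟩
  have hA1 : 1 ≤ A := le_trans (by norm_num) hA2
  have hApos : (0 : ℝ) < A := by exact_mod_cast (lt_of_lt_of_le (by norm_num) hA2 : 0 < A)
  have hP : 0 < cardyFunction (lamR A) := g_cardy_lamR_pos hApos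
  -- Step 2: lattice Cardy along widths `w = k - 2`
  have hRw : Tendsto (fun w : ℕ ↦ crossingProb half (A * (w + 2) - 2) w) atTop (𝓝 (cardyFunction (lamR A))) := by
    have := (hR A hA1).comp (tendsto_add_atTop_nat 2)
    refine this.congr' (Eventually.of_forall fun w ↦ ?_)
    simp only [Function.comp_apply, Nat.add_sub_cancel]
  have hup := g_tendsto_upper hA2 hP hRw
  have hlow := g_tendsto_lower hA2 hP hRw
  -- eventually the two bounding sequences are within `ε` of `π/3`
  have eup := hup.eventually (gt_mem_nhds (show (Real.log 2 + -Real.log (cardyFunction (lamR A))) / ((A : ℝ) - 1) <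
    Real.pi / 3 + ε by linarith))
  have elow := hlow.eventually (lt_mem_nhds (show Real.pi / 3 - ε < -Real.log (cardyFunction (lamR A)) / (A : ℝ) by
    linarith))
  obtain ⟨N, hN⟩ := ((eventually_ge_atTop 1).and (eup.and elow)).exists_forall_of_atTop
  refine ⟨N, fun w hw ↦ ?_⟩
  obtain ⟨hw1, hwup, hwlow⟩ := hN w hw
  have hw0 : (0 : ℝ) ≤ w := by positivity
  -- the sandwich at width `w`, length `m_w`
  have hlt : w < A * (w + 2) - 2 := by
    have : 2 * (w + 2) ≤ A * (w + 2) := Nat.mul_le_mul_right _ hA2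
    omega
  have hupper : (w : ℝ) * γ w ≤ (w : ℝ) * ((Real.log 2 - Real.log (crossingProb half (A * (w + 2) - 2) w)) /
      (((A * (w + 2) - 2 : ℕ) : ℝ) - w)) :=
    mul_le_mul_of_nonneg_left (hA w hw1 (γ w) (hγ w hw1) _ hlt) hw0
  have hlower : (w : ℝ) * (-Real.log (crossingProb half (A * (w + 2) - 2) w) /
      (((A * (w + 2) - 2 : ℕ) : ℝ) + 1)) ≤ (w : ℝ) * γ w :=
    mul_le_mul_of_nonneg_left (rateOne_ge_finite (hγ w hw1) (A * (w + 2) - 2)) hw0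
  rw [Real.dist_eq, abs_sub_lt_iff]
  constructor <;> linarith

end Summit.CriticalPhenomena.CardyFormulaZ2.Cruxes.StripClusterRates.TwoClusterRateIsStationaryGap

end
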